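import Summits.Ventures.HSemireg.WedgeHankelRecurrenceGaussMinorInterlace

/-!
# Venture HSemireg — **LAURIE'S ANTI-GAUSS RULE (1996) IN THE RECURRENCE PICTURE**: doubling the LAST coupling, `b̃_{t+1} = 2 b_{t+1}` (all other coefficients unchanged), gives
# `q̃_n = q_n` (`n ≤ t + 1`) and `q̃_{t+2} = q_{t+2} − b_{t+1} q_t`; the Favard rule `(ν, y)` of `q̃` at level `t + 1` (`t + 2` nodes, positive weights) is the ANTI-GAUSS rule:
# `Σ_K ν_K f(y_K) = 2·Σ_K M_K f(X_K) − Σ_k μ_k f(x_k)` for every `f` of degree `≤ 2t + 3`, where `(μ, x)` is the `(t+1)`-point Gauss (Favard) rule of `q` and `(M, X)` the `(t+2)`-point one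
# (which represents the underlying measure exactly in degree `≤ 2t + 3`); i.e. the anti-Gauss error is the NEGATIVE of the Gauss error on polynomials of degree `≤ 2t + 3`.  Its nodes
# interlace the Gauss nodes (N279) and spread beyond the nodes of `q_{t+2}` (N349)

HONEST FRAMING. Part of the Lean index of the computation cell `pub-hsemireg` (seat p10 gen 45, Sunday typer «UNIFORM-IN-n»).  Real polynomials and finite sums only (`Polynomial.modByMonic`); no
variety, no cohomology theory, no sheaf, no Ext group and no semiregularity map is constructed here; nothing here says that HC / HC_CM / HC_AV holds; no Literature fact (unproved `Prop`) is declared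
or used.  Custodian versions as in `WedgeHankelSiegelIdeal` (1/3).
SOURCES (cited).  D. P. Laurie, *Anti-Gaussian quadrature formulas*, Math. Comp. 65 (1996) 739–747, Thm 1 ∕ (9)–(12) (the anti-Gauss rule is the Gauss rule of the functional `2I − G_n`, whose
Jacobi matrix is that of `I` with the last off-diagonal entry multiplied by `√2`); D. Calvetti, L. Reichel, *Symmetric Gauss–Lobatto and modified anti-Gauss rules*, BIT 43 (2003) 541–554, §2;
W. Gautschi, *Orthogonal Polynomials: Computation and Approximation* (2004) §3.1.3.
PROOF TYPED HERE.  With `L(F) = 2 Σ M F(X) − Σ μ F(x)`: the Favard pairings give `L(q_i q_j) = δ_{ij} h̃_j` (`h̃_j = h_j`, `j ≤ t`, `h̃_{t+1} = 2 h_{t+1}`) and, by `q_{t+2}(x_k) = −b_{t+1} q_t(x_k)`,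
`L(q̃_{t+2} q_j) = 0` (`j ≤ t + 1`); a linear functional vanishing on the monic family `q_0, …, q_{t+1}` vanishes in degree `≤ t + 1`, so `L(q̃_{t+2} G) = 0` for `deg G ≤ t + 1` and
`Σ ν R(y) = L(R)` for `deg R ≤ t + 1`; division of `f` by the monic `q̃_{t+2}` finishes.
DEDUP DISCLOSURE (`rg -n 'antiGauss|anti_gauss|Laurie' Summits Literature`, 2026-09-03): nothing.  The 11 names below: 0 hits tree-wide.

WHAT IS IN THE TREE.  N323 `favard_pairing_at_zeros`; N279 `recurrence_monic_natDegree`, `recurrence_zeros_interlace`; N269 `natDegree_sub_C_mul_le_of_monic`; N294 `strictMono_eq_of_prod_X_sub_C_eq`;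
N346 ∕ N349 (interlacing ∕ spreading for a single coupling); Mathlib `Polynomial.modByMonic_add_div`, `natDegree_modByMonic_lt`, `natDegree_divByMonic`.
THIS FILE (namespace `Summit.Ventures.HSemireg.Wedge.HankelOuter` continued; CHAINED on N365 (import only); 0 definitions):
* §1131 `sum_mul_eval_mul_add` ∕ `sum_mul_eval_mul_smul` (linearity bookkeeping), `antiGauss_recurrence_eq` (`q̃_n = q_n`, `n ≤ t+1`; `q̃_{t+2} = q_{t+2} − b_{t+1} q_t`), `functional_vanish_of_monic_family` (an additive, `C`-homogeneous `Φ : ℝ[X] → ℝ` vanishing on a monic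
  family of degrees `0..n` vanishes in degree `≤ n`), `antiGauss_pairing` (`L(q_i q_j) = δ_{ij} h̃_j`), `antiGauss_top_orthogonal_basis` (`L(q̃_{t+2} q_j) = 0`), `antiGauss_top_orthogonal`
  (`L(q̃_{t+2} G) = 0`, `deg G ≤ t+1`), `antiGauss_low_degree` (`Σ ν R(y) = L(R)`, `deg R ≤ t+1`), **`antiGauss_exact`** (`Σ ν f(y) = 2 Σ M f(X) − Σ μ f(x)`, `deg f ≤ 2t+3`),
  **`antiGauss_rule`** (packaged: positive weights exist with the averaged identity `(AG + G)∕2 = G_{t+2}` on degree `≤ 2t+3`, and the anti-Gauss nodes interlace the Gauss nodes), `antiGauss_nodes_vs_gauss` (versus the `(t+2)`-point Gauss nodes: extremes strictly outside, N349; shifts ≤ 1, N346).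
CAVEATS.  Positive recurrences; the reference functional is the `(t+2)`-point Favard rule of the same recurrence (which agrees with any underlying measure in degree `≤ 2t+3`).  Nothing Ext-side.
New names only.
-/

open Module Polynomial
open scoped Matrix Polynomial

namespace Summit.Ventures.HSemireg.Wedge.HankelOuter

/-! ## §1131. The anti-Gauss rule -/

/-- **Doubling the last coupling: `q̃_n = q_n` for `n ≤ t + 1` and `q̃_{t+2} = q_{t+2} − b_{t+1} q_t`.** [Laurie 1996 (12); this file, §1131] -/
theorem antiGauss_recurrence_eq {q q' : ℕ → ℝ[X]} {a b b' : ℕ → ℝ} (hq0 : q 0 = 1) (hq1 : q 1 = Polynomial.X - C (a 0))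
    (hrec : ∀ n, q (n + 2) = (Polynomial.X - C (a (n + 1))) * q (n + 1) - C (b (n + 1)) * q n)
    (hq0' : q' 0 = 1) (hq1' : q' 1 = Polynomial.X - C (a 0)) (hrec' : ∀ n, q' (n + 2) = (Polynomial.X - C (a (n + 1))) * q' (n + 1) - C (b' (n + 1)) * q' n)
    {t : ℕ} (hb' : ∀ j, j ≠ t + 1 → b' j = b j) (hbt : b' (t + 1) = 2 * b (t + 1)) :
    (∀ n, n ≤ t + 1 → q' n = q n) ∧ q' (t + 2) = q (t + 2) - C (b (t + 1)) * q t := by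
  have key : ∀ n, n ≤ t + 1 → q' n = q n ∧ (n + 1 ≤ t + 1 → q' (n + 1) = q (n + 1)) := by
    intro n
    induction n with
    | zero => exact fun _ => ⟨by rw [hq0, hq0'], fun _ => by rw [hq1, hq1']⟩
    | succ n ih =>
      intro hn
      obtain ⟨h0, h1⟩ := ih (by omega)
      refine ⟨h1 hn, fun h2 => ?_⟩
      rw [show n + 1 + 1 = n + 2 by ring, hrec n, hrec' n, h0, h1 hn, hb' (n + 1) (by omega)]
  have hbelow : ∀ n, n ≤ t + 1 → q' n = q n := fun n hn => (key n hn).1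
  refine ⟨hbelow, ?_⟩
  rw [hrec' t, hrec t, hbelow (t + 1) le_rfl, hbelow t (by omega), hbt, C_mul, show (C (2 : ℝ) : ℝ[X]) = 2 from rfl]
  ring

/-- **A linear functional vanishing on a monic family vanishes in low degree**: `Φ` additive and `C`-homogeneous, `q_d` monic of degree `d` and `Φ(q_d) = 0` for `d ≤ n` ⇒ `Φ(R) = 0` for
`deg R ≤ n`. [bookkeeping; this file, §1131] -/
theorem functional_vanish_of_monic_family {Φ : ℝ[X] → ℝ} (hadd : ∀ F G : ℝ[X], Φ (F + G) = Φ F + Φ G) (hsmul : ∀ (c : ℝ) (F : ℝ[X]), Φ (C c * F) = c * Φ F)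
    {q : ℕ → ℝ[X]} {n : ℕ} (hmonic : ∀ d, d ≤ n → (q d).Monic) (hdeg : ∀ d, d ≤ n → (q d).natDegree = d) (hΦ : ∀ d, d ≤ n → Φ (q d) = 0)
    {R : ℝ[X]} (hR : R.natDegree ≤ n) : Φ R = 0 := by
  have key : ∀ e, e ≤ n → ∀ R : ℝ[X], R.natDegree ≤ e → Φ R = 0 := by
    intro e
    induction e with
    | zero =>
      intro _ R hR
      have hR0 : R = C (R.coeff 0) * q 0 := by rw [eq_one_of_monic_natDegree_zero (hmonic 0 (Nat.zero_le _)) (hdeg 0 (Nat.zero_le _)), mul_one]; exact eq_C_of_natDegree_le_zero hR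
      rw [hR0, hsmul, hΦ 0 (Nat.zero_le _), mul_zero]
    | succ e ih =>
      intro he R hR
      have hR' : (R - C (R.coeff (e + 1)) * q (e + 1)).natDegree ≤ e := by
        have := natDegree_sub_C_mul_le_of_monic hR (hmonic (e + 1) he) (hdeg (e + 1) he)
        simpa using this
      have h1 := ih (by omega) _ hR'
      have h2 : Φ R = Φ (R - C (R.coeff (e + 1)) * q (e + 1)) + R.coeff (e + 1) * Φ (q (e + 1)) := by
        rw [← hsmul, ← hadd, sub_add_cancel]
      rw [h2, h1, hΦ (e + 1) he, mul_zero, add_zero]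
  exact key n le_rfl R hR

/-- `Σ_k w_k ((P·(F+G))(z_k)) = Σ_k w_k (P F)(z_k) + Σ_k w_k (P G)(z_k)`. [bookkeeping; this file, §1131] -/
theorem sum_mul_eval_mul_add {N : ℕ} (w z : Fin N → ℝ) (P F G : ℝ[X]) :
    ∑ k, w k * (P * (F + G)).eval (z k) = ∑ k, w k * (P * F).eval (z k) + ∑ k, w k * (P * G).eval (z k) := by
  rw [← Finset.sum_add_distrib]; exact Finset.sum_congr rfl fun k _ => by rw [mul_add, eval_add, mul_add]

/-- `Σ_k w_k ((P·(c F))(z_k)) = c · Σ_k w_k (P F)(z_k)`. [bookkeeping; this file, §1131] -/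
theorem sum_mul_eval_mul_smul {N : ℕ} (w z : Fin N → ℝ) (P F : ℝ[X]) (c : ℝ) :
    ∑ k, w k * (P * (C c * F)).eval (z k) = c * ∑ k, w k * (P * F).eval (z k) := by
  rw [Finset.mul_sum]; exact Finset.sum_congr rfl fun k _ => by simp only [eval_mul, eval_C]; ring

/-- **The anti-Gauss functional on the basis: `L(q_i q_j) = δ_{ij} h̃_j`** with `L(F) = 2 Σ M F(X) − Σ μ F(x)`, `(μ, x)` ∕ `(M, X)` the Favard pairings of `q` at levels `t` ∕ `t + 1`, and
`h̃_j = b̃_1⋯b̃_j` (`= h_j` for `j ≤ t`, `= 2h_{t+1}` for `j = t + 1`). [Laurie 1996 §2; this file, §1131] -/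
theorem antiGauss_pairing {q : ℕ → ℝ[X]} {b b' : ℕ → ℝ} {t : ℕ} (hb' : ∀ j, j ≠ t + 1 → b' j = b j) (hbt : b' (t + 1) = 2 * b (t + 1))
    {μ x : Fin (t + 1) → ℝ} {M X : Fin (t + 2) → ℝ} (hxr : ∀ k, (q (t + 1)).eval (x k) = 0)
    (hpair : ∀ i j : Fin (t + 1), ∑ k, μ k * ((q i).eval (x k) * (q j).eval (x k)) = if i = j then ∏ l ∈ Finset.Ico 1 ((j : ℕ) + 1), b l else 0)
    (hPair : ∀ i j : Fin (t + 2), ∑ k, M k * ((q i).eval (X k) * (q j).eval (X k)) = if i = j then ∏ l ∈ Finset.Ico 1 ((j : ℕ) + 1), b l else 0) (i j : Fin (t + 2)) :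
    2 * ∑ k, M k * ((q i).eval (X k) * (q j).eval (X k)) - ∑ k, μ k * ((q i).eval (x k) * (q j).eval (x k)) = if i = j then ∏ l ∈ Finset.Ico 1 ((j : ℕ) + 1), b' l else 0 := by
  -- the modified norms
  have hh' : ∀ n, n ≤ t → ∏ l ∈ Finset.Ico 1 (n + 1), b' l = ∏ l ∈ Finset.Ico 1 (n + 1), b l := fun n hn =>
    Finset.prod_congr rfl fun l hl => hb' l (by have := (Finset.mem_Ico.1 hl).2; omega)
  have hh't : ∏ l ∈ Finset.Ico 1 (t + 1 + 1), b' l = 2 * ∏ l ∈ Finset.Ico 1 (t + 1 + 1), b l := by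
    rw [prod_Ico_one_succ_succ b' t, prod_Ico_one_succ_succ b t, hh' t le_rfl, hbt]; ring
  rw [hPair]
  -- the `μ`-sum: zero if `i` or `j` is the top index, else the level-`t` pairing
  by_cases hi : (i : ℕ) = t + 1
  · have hzero : ∑ k, μ k * ((q i).eval (x k) * (q j).eval (x k)) = 0 := Finset.sum_eq_zero fun k _ => by rw [hi, hxr k, zero_mul, mul_zero]
    rw [hzero, sub_zero]
    by_cases hij : i = j
    · subst hij; rw [if_pos rfl, if_pos rfl, hi, hh't]
    · rw [if_neg hij, if_neg hij, mul_zero]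
  · by_cases hj : (j : ℕ) = t + 1
    · have hzero : ∑ k, μ k * ((q i).eval (x k) * (q j).eval (x k)) = 0 := Finset.sum_eq_zero fun k _ => by rw [hj, hxr k, mul_zero, mul_zero]
      have hij : i ≠ j := fun h => hi (by rw [h]; exact hj)
      rw [hzero, sub_zero, if_neg hij, if_neg hij, mul_zero]
    · have hi' : (i : ℕ) < t + 1 := by have := i.is_lt; omega
      have hj' : (j : ℕ) < t + 1 := by have := j.is_lt; omega
      have h := hpair ⟨i, hi'⟩ ⟨j, hj'⟩
      dsimp only at h
      rw [h]
      by_cases hij : i = j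
      · subst hij; rw [if_pos rfl, if_pos rfl, if_pos rfl, hh' i (by omega)]; ring
      · rw [if_neg hij, if_neg (fun h => hij (Fin.ext (Fin.mk.inj_iff.1 h))), if_neg hij]; ring

/-- **`L(q̃_{t+2} q_j) = 0` for `j ≤ t + 1`** (`q̃_{t+2} = q_{t+2} − b_{t+1} q_t`, `q_{t+2}(x_k) = −b_{t+1} q_t(x_k)`). [Laurie 1996 §2; this file, §1131] -/
theorem antiGauss_top_orthogonal_basis {q : ℕ → ℝ[X]} {a b : ℕ → ℝ}
    (hrec : ∀ n, q (n + 2) = (Polynomial.X - C (a (n + 1))) * q (n + 1) - C (b (n + 1)) * q n)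
    {t : ℕ} {μ x : Fin (t + 1) → ℝ} {M X : Fin (t + 2) → ℝ} (hxr : ∀ k, (q (t + 1)).eval (x k) = 0) (hXr : ∀ k, (q (t + 2)).eval (X k) = 0)
    (hpair : ∀ i j : Fin (t + 1), ∑ k, μ k * ((q i).eval (x k) * (q j).eval (x k)) = if i = j then ∏ l ∈ Finset.Ico 1 ((j : ℕ) + 1), b l else 0)
    (hPair : ∀ i j : Fin (t + 2), ∑ k, M k * ((q i).eval (X k) * (q j).eval (X k)) = if i = j then ∏ l ∈ Finset.Ico 1 ((j : ℕ) + 1), b l else 0) (j : Fin (t + 2)) :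
    2 * ∑ k, M k * ((q (t + 2) - C (b (t + 1)) * q t) * q j).eval (X k) - ∑ k, μ k * ((q (t + 2) - C (b (t + 1)) * q t) * q j).eval (x k) = 0 := by
  have hlink : ∀ k, (q (t + 2)).eval (x k) = -b (t + 1) * (q t).eval (x k) := fun k => by
    have h := congrArg (eval (x k)) (hrec t)
    simp only [eval_sub, eval_mul, eval_X, eval_C, hxr k, mul_zero, zero_sub] at h
    rw [h]; ring
  -- expand both sums
  have e1 : ∀ k, M k * ((q (t + 2) - C (b (t + 1)) * q t) * q j).eval (X k) = -b (t + 1) * (M k * ((q t).eval (X k) * (q j).eval (X k))) := fun k => by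
    simp only [eval_mul, eval_sub, eval_C, hXr k, zero_sub]; ring
  have e2 : ∀ k, μ k * ((q (t + 2) - C (b (t + 1)) * q t) * q j).eval (x k) = -(2 * b (t + 1)) * (μ k * ((q t).eval (x k) * (q j).eval (x k))) := fun k => by
    simp only [eval_mul, eval_sub, eval_C, hlink k]; ring
  rw [Finset.sum_congr rfl fun k _ => e1 k, Finset.sum_congr rfl fun k _ => e2 k, ← Finset.mul_sum, ← Finset.mul_sum]
  -- both pairings of `q_t` with `q_j` have the same value
  have hSM := hPair ⟨t, by omega⟩ j
  have hSμ : ∑ k, μ k * ((q t).eval (x k) * (q j).eval (x k)) = if (⟨t, by omega⟩ : Fin (t + 2)) = j then ∏ l ∈ Finset.Ico 1 ((j : ℕ) + 1), b l else 0 := by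
    by_cases hjt : (j : ℕ) = t + 1
    · rw [if_neg (fun h => by rw [← h] at hjt; simp at hjt), hjt]
      exact Finset.sum_eq_zero fun k _ => by rw [hxr k, mul_zero, mul_zero]
    · have h := hpair ⟨t, by omega⟩ ⟨j, by have := j.is_lt; omega⟩
      dsimp only at h
      rw [h]
      by_cases hj : (⟨t, by omega⟩ : Fin (t + 2)) = j
      · have hjv : (j : ℕ) = t := by rw [← hj]
        rw [if_pos hj, if_pos (Fin.ext (by simp [hjv]))]
      · have hjv : (j : ℕ) ≠ t := fun h' => hj (Fin.ext (by simp [h']))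
        rw [if_neg hj, if_neg (fun h' => hjv (by have := Fin.mk.inj_iff.1 h'; omega))]
  dsimp only at hSM
  rw [hSM, hSμ]
  ring

/-- **`L(q̃_{t+2} G) = 0` for every `G` of degree `≤ t + 1`.** [Laurie 1996 Thm 1 (proof); this file, §1131] -/
theorem antiGauss_top_orthogonal {q : ℕ → ℝ[X]} {a b : ℕ → ℝ} (hq0 : q 0 = 1) (hq1 : q 1 = Polynomial.X - C (a 0))
    (hrec : ∀ n, q (n + 2) = (Polynomial.X - C (a (n + 1))) * q (n + 1) - C (b (n + 1)) * q n)
    {t : ℕ} {μ x : Fin (t + 1) → ℝ} {M X : Fin (t + 2) → ℝ} (hxr : ∀ k, (q (t + 1)).eval (x k) = 0) (hXr : ∀ k, (q (t + 2)).eval (X k) = 0)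
    (hpair : ∀ i j : Fin (t + 1), ∑ k, μ k * ((q i).eval (x k) * (q j).eval (x k)) = if i = j then ∏ l ∈ Finset.Ico 1 ((j : ℕ) + 1), b l else 0)
    (hPair : ∀ i j : Fin (t + 2), ∑ k, M k * ((q i).eval (X k) * (q j).eval (X k)) = if i = j then ∏ l ∈ Finset.Ico 1 ((j : ℕ) + 1), b l else 0)
    {G : ℝ[X]} (hG : G.natDegree ≤ t + 1) :
    2 * ∑ k, M k * ((q (t + 2) - C (b (t + 1)) * q t) * G).eval (X k) - ∑ k, μ k * ((q (t + 2) - C (b (t + 1)) * q t) * G).eval (x k) = 0 := by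
  refine functional_vanish_of_monic_family (Φ := fun F => 2 * ∑ k, M k * ((q (t + 2) - C (b (t + 1)) * q t) * F).eval (X k) - ∑ k, μ k * ((q (t + 2) - C (b (t + 1)) * q t) * F).eval (x k))
    (fun F G => ?_) (fun c F => ?_) (fun d hd => (recurrence_monic_natDegree hq0 hq1 hrec d).1) (fun d hd => (recurrence_monic_natDegree hq0 hq1 hrec d).2) (fun d hd => ?_) hG
  · simp only [sum_mul_eval_mul_add]; ring
  · simp only [sum_mul_eval_mul_smul]; ring
  · have h := antiGauss_top_orthogonal_basis hrec hxr hXr hpair hPair ⟨d, by omega⟩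
    exact h

/-- **In low degree the anti-Gauss rule agrees with `L`: `Σ ν R(y) = 2 Σ M R(X) − Σ μ R(x)` for `deg R ≤ t + 1`** (`(ν, y)` the Favard pairing of `q̃` at level `t + 1`). [this file, §1131] -/
theorem antiGauss_low_degree {q q' : ℕ → ℝ[X]} {a b b' : ℕ → ℝ} (hq0 : q 0 = 1) (hq1 : q 1 = Polynomial.X - C (a 0))
    (hrec : ∀ n, q (n + 2) = (Polynomial.X - C (a (n + 1))) * q (n + 1) - C (b (n + 1)) * q n)
    (hq0' : q' 0 = 1) (hq1' : q' 1 = Polynomial.X - C (a 0)) (hrec' : ∀ n, q' (n + 2) = (Polynomial.X - C (a (n + 1))) * q' (n + 1) - C (b' (n + 1)) * q' n)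
    {t : ℕ} (hb' : ∀ j, j ≠ t + 1 → b' j = b j) (hbt : b' (t + 1) = 2 * b (t + 1))
    {μ x : Fin (t + 1) → ℝ} {M X : Fin (t + 2) → ℝ} {ν y : Fin (t + 2) → ℝ} (hxr : ∀ k, (q (t + 1)).eval (x k) = 0)
    (hpair : ∀ i j : Fin (t + 1), ∑ k, μ k * ((q i).eval (x k) * (q j).eval (x k)) = if i = j then ∏ l ∈ Finset.Ico 1 ((j : ℕ) + 1), b l else 0)
    (hPair : ∀ i j : Fin (t + 2), ∑ k, M k * ((q i).eval (X k) * (q j).eval (X k)) = if i = j then ∏ l ∈ Finset.Ico 1 ((j : ℕ) + 1), b l else 0)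
    (hpair' : ∀ i j : Fin (t + 2), ∑ k, ν k * ((q' i).eval (y k) * (q' j).eval (y k)) = if i = j then ∏ l ∈ Finset.Ico 1 ((j : ℕ) + 1), b' l else 0)
    {R : ℝ[X]} (hR : R.natDegree ≤ t + 1) :
    ∑ k, ν k * R.eval (y k) = 2 * ∑ k, M k * R.eval (X k) - ∑ k, μ k * R.eval (x k) := by
  obtain ⟨hbelow, -⟩ := antiGauss_recurrence_eq hq0 hq1 hrec hq0' hq1' hrec' hb' hbt
  have h := functional_vanish_of_monic_family (Φ := fun F => ∑ k, ν k * F.eval (y k) - (2 * ∑ k, M k * F.eval (X k) - ∑ k, μ k * F.eval (x k)))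
    (fun F G => by
      have h1 := sum_mul_eval_mul_add ν y 1 F G; have h2 := sum_mul_eval_mul_add M X 1 F G; have h3 := sum_mul_eval_mul_add μ x 1 F G
      simp only [one_mul] at h1 h2 h3; rw [h1, h2, h3]; ring)
    (fun c F => by
      have h1 := sum_mul_eval_mul_smul ν y 1 F c; have h2 := sum_mul_eval_mul_smul M X 1 F c; have h3 := sum_mul_eval_mul_smul μ x 1 F c
      simp only [one_mul] at h1 h2 h3; rw [h1, h2, h3]; ring)
    (fun d hd => (recurrence_monic_natDegree hq0 hq1 hrec d).1) (fun d hd => (recurrence_monic_natDegree hq0 hq1 hrec d).2) (fun d hd => ?_) hR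
  · simpa [sub_eq_zero] using h
  · -- on `q_d = q_d · q_0`: both sides equal `[d = 0]`
    have h1 := hpair' ⟨d, by omega⟩ ⟨0, by omega⟩
    have h2 := antiGauss_pairing (q := q) hb' hbt hxr hpair hPair ⟨d, by omega⟩ ⟨0, by omega⟩
    rw [hbelow d hd, hq0'] at h1
    rw [hq0] at h2
    simp only [eval_one, mul_one] at h1 h2
    rw [h1, h2, sub_self]

/-- **LAURIE'S THEOREM: the anti-Gauss rule is exact for `2I − G` up to degree `2t + 3`: `Σ_K ν_K f(y_K) = 2 Σ_K M_K f(X_K) − Σ_k μ_k f(x_k)` for `deg f ≤ 2t + 3`.** [Laurie 1996 Thm 1;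
this file, §1131] -/
theorem antiGauss_exact {q q' : ℕ → ℝ[X]} {a b b' : ℕ → ℝ} (hq0 : q 0 = 1) (hq1 : q 1 = Polynomial.X - C (a 0))
    (hrec : ∀ n, q (n + 2) = (Polynomial.X - C (a (n + 1))) * q (n + 1) - C (b (n + 1)) * q n)
    (hq0' : q' 0 = 1) (hq1' : q' 1 = Polynomial.X - C (a 0)) (hrec' : ∀ n, q' (n + 2) = (Polynomial.X - C (a (n + 1))) * q' (n + 1) - C (b' (n + 1)) * q' n)
    {t : ℕ} (hb' : ∀ j, j ≠ t + 1 → b' j = b j) (hbt : b' (t + 1) = 2 * b (t + 1))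
    {μ x : Fin (t + 1) → ℝ} {M X : Fin (t + 2) → ℝ} {ν y : Fin (t + 2) → ℝ}
    (hxq : q (t + 1) = ∏ k, (Polynomial.X - C (x k))) (hXq : q (t + 2) = ∏ k, (Polynomial.X - C (X k))) (hyq : q' (t + 2) = ∏ k, (Polynomial.X - C (y k)))
    (hpair : ∀ i j : Fin (t + 1), ∑ k, μ k * ((q i).eval (x k) * (q j).eval (x k)) = if i = j then ∏ l ∈ Finset.Ico 1 ((j : ℕ) + 1), b l else 0)
    (hPair : ∀ i j : Fin (t + 2), ∑ k, M k * ((q i).eval (X k) * (q j).eval (X k)) = if i = j then ∏ l ∈ Finset.Ico 1 ((j : ℕ) + 1), b l else 0)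
    (hpair' : ∀ i j : Fin (t + 2), ∑ k, ν k * ((q' i).eval (y k) * (q' j).eval (y k)) = if i = j then ∏ l ∈ Finset.Ico 1 ((j : ℕ) + 1), b' l else 0)
    {f : ℝ[X]} (hf : f.natDegree ≤ 2 * t + 3) :
    ∑ k, ν k * f.eval (y k) = 2 * ∑ k, M k * f.eval (X k) - ∑ k, μ k * f.eval (x k) := by
  have hxr : ∀ k, (q (t + 1)).eval (x k) = 0 := fun k => by
    rw [hxq, eval_prod]; exact Finset.prod_eq_zero (Finset.mem_univ k) (by rw [eval_sub, eval_X, eval_C, sub_self])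
  have hXr : ∀ k, (q (t + 2)).eval (X k) = 0 := fun k => by
    rw [hXq, eval_prod]; exact Finset.prod_eq_zero (Finset.mem_univ k) (by rw [eval_sub, eval_X, eval_C, sub_self])
  have hyr : ∀ k, (q' (t + 2)).eval (y k) = 0 := fun k => by
    rw [hyq, eval_prod]; exact Finset.prod_eq_zero (Finset.mem_univ k) (by rw [eval_sub, eval_X, eval_C, sub_self])
  obtain ⟨-, htop⟩ := antiGauss_recurrence_eq hq0 hq1 hrec hq0' hq1' hrec' hb' hbt
  obtain ⟨hm', hd'⟩ := recurrence_monic_natDegree hq0' hq1' hrec' (t + 2)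
  -- division by the monic `q̃_{t+2}`
  obtain ⟨G, hG⟩ : ∃ G : ℝ[X], G = f /ₘ q' (t + 2) := ⟨_, rfl⟩
  obtain ⟨R, hR⟩ : ∃ R : ℝ[X], R = f %ₘ q' (t + 2) := ⟨_, rfl⟩
  have hfGR : f = q' (t + 2) * G + R := by rw [hG, hR, add_comm, modByMonic_add_div f (q' (t + 2))]
  have hRd : R.natDegree ≤ t + 1 := by
    have hne : q' (t + 2) ≠ 1 := fun h => by have := congrArg natDegree h; rw [hd', natDegree_one] at this; omega
    have := natDegree_modByMonic_lt f hm' hne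
    rw [hd'] at this; rw [hR]; omega
  have hGd : G.natDegree ≤ t + 1 := by
    rw [hG, natDegree_divByMonic f hm', hd']; omega
  have h1 := antiGauss_top_orthogonal hq0 hq1 hrec hxr hXr hpair hPair hGd
  have h2 := antiGauss_low_degree hq0 hq1 hrec hq0' hq1' hrec' hb' hbt hxr hpair hPair hpair' hRd
  rw [← htop] at h1
  -- the left side sees only `R`
  have h3 : ∑ k, ν k * f.eval (y k) = ∑ k, ν k * R.eval (y k) := Finset.sum_congr rfl fun k _ => by rw [hfGR, eval_add, eval_mul, hyr k, zero_mul, zero_add]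
  have h4 : 2 * ∑ k, M k * f.eval (X k) - ∑ k, μ k * f.eval (x k) =
      (2 * ∑ k, M k * (q' (t + 2) * G).eval (X k) - ∑ k, μ k * (q' (t + 2) * G).eval (x k)) + (2 * ∑ k, M k * R.eval (X k) - ∑ k, μ k * R.eval (x k)) := by
    simp only [hfGR, eval_add, mul_add, Finset.sum_add_distrib]; ring
  rw [h3, h4, h1, zero_add, h2]

/-- **THE ANTI-GAUSS RULE, PACKAGED (Laurie 1996)**: for a positive recurrence and the zeros `x` of `q_{t+1}`, `X` of `q_{t+2}`, `y` of `q̃_{t+2}` (`q̃`: last coupling doubled) there are POSITIVE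
weights `μ, M, ν` (the Favard weights) with `(Σ ν f(y) + Σ μ f(x))∕2 = Σ M f(X)` for every `f` of degree `≤ 2t + 3` (the averaged rule has the exactness of the `(t+2)`-point Gauss rule), and
the anti-Gauss nodes INTERLACE the Gauss nodes: `y_k < x_k < y_{k+1}`. [Laurie 1996 Thm 1 and §3; this file, §1131] -/
theorem antiGauss_rule {q q' : ℕ → ℝ[X]} {a b b' : ℕ → ℝ} (hq0 : q 0 = 1) (hq1 : q 1 = Polynomial.X - C (a 0))
    (hrec : ∀ n, q (n + 2) = (Polynomial.X - C (a (n + 1))) * q (n + 1) - C (b (n + 1)) * q n)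
    (hq0' : q' 0 = 1) (hq1' : q' 1 = Polynomial.X - C (a 0)) (hrec' : ∀ n, q' (n + 2) = (Polynomial.X - C (a (n + 1))) * q' (n + 1) - C (b' (n + 1)) * q' n)
    (hb : ∀ j, 0 < b j) {t : ℕ} (hb' : ∀ j, j ≠ t + 1 → b' j = b j) (hbt : b' (t + 1) = 2 * b (t + 1))
    {x : Fin (t + 1) → ℝ} {X y : Fin (t + 2) → ℝ} (hx : StrictMono x) (hxq : q (t + 1) = ∏ k, (Polynomial.X - C (x k)))
    (hX : StrictMono X) (hXq : q (t + 2) = ∏ k, (Polynomial.X - C (X k))) (hy : StrictMono y) (hyq : q' (t + 2) = ∏ k, (Polynomial.X - C (y k))) :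
    ∃ (μ : Fin (t + 1) → ℝ) (M ν : Fin (t + 2) → ℝ), (∀ k, 0 < μ k) ∧ (∀ k, 0 < M k) ∧ (∀ k, 0 < ν k) ∧
      (∀ f : ℝ[X], f.natDegree ≤ 2 * t + 3 → ∑ k, ν k * f.eval (y k) + ∑ k, μ k * f.eval (x k) = 2 * ∑ k, M k * f.eval (X k)) ∧
      ∀ k : Fin (t + 1), y k.castSucc < x k ∧ x k < y k.succ := by
  have hb'pos : ∀ j, 0 < b' j := fun j => by
    by_cases h : j = t + 1
    · rw [h, hbt]; exact mul_pos two_pos (hb _)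
    · rw [hb' j h]; exact hb j
  obtain ⟨μ, hμ, hpair⟩ := favard_pairing_at_zeros hq0 hq1 hrec hb hx hxq
  obtain ⟨M, hM, hPair⟩ := favard_pairing_at_zeros hq0 hq1 hrec hb (t := t + 1) hX hXq
  obtain ⟨ν, hν, hpair'⟩ := favard_pairing_at_zeros hq0' hq1' hrec' hb'pos (t := t + 1) hy hyq
  refine ⟨μ, M, ν, hμ, hM, hν, fun f hf => ?_, ?_⟩
  · rw [antiGauss_exact hq0 hq1 hrec hq0' hq1' hrec' hb' hbt hxq hXq hyq hpair hPair hpair' hf]; ring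
  · -- interlacing with the zeros of `q̃_{t+1} = q_{t+1}`
    obtain ⟨hbelow, -⟩ := antiGauss_recurrence_eq hq0 hq1 hrec hq0' hq1' hrec' hb' hbt
    obtain ⟨z, w, hz, hw, hzq, hwq, hzw⟩ := recurrence_zeros_interlace hq0' hq1' hrec' hb'pos t
    have hzx : z = x := strictMono_eq_of_prod_X_sub_C_eq hz hx (hzq.symm.trans ((hbelow (t + 1) le_rfl).trans hxq))
    have hwy : w = y := strictMono_eq_of_prod_X_sub_C_eq hw hy (hwq.symm.trans hyq)
    subst hzx hwy
    exact hzw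

/-- **The anti-Gauss nodes versus the `(t+2)`-point Gauss nodes**: `y_0 < X_0`, `X_{t+1} < y_{t+1}` (strict Perron, N349, one coupling doubled) and `y_k ≤ X_{k+1}`, `X_k ≤ y_{k+1}`
(Weyl for a single coupling, N346). [Laurie 1996 §3; this file, §1131] -/
theorem antiGauss_nodes_vs_gauss {q q' : ℕ → ℝ[X]} {a b b' : ℕ → ℝ} (hq0 : q 0 = 1) (hq1 : q 1 = Polynomial.X - C (a 0))
    (hrec : ∀ n, q (n + 2) = (Polynomial.X - C (a (n + 1))) * q (n + 1) - C (b (n + 1)) * q n)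
    (hq0' : q' 0 = 1) (hq1' : q' 1 = Polynomial.X - C (a 0)) (hrec' : ∀ n, q' (n + 2) = (Polynomial.X - C (a (n + 1))) * q' (n + 1) - C (b' (n + 1)) * q' n)
    (hb : ∀ j, 0 < b j) {t : ℕ} (hb' : ∀ j, j ≠ t + 1 → b' j = b j) (hbt : b' (t + 1) = 2 * b (t + 1))
    {X y : Fin (t + 2) → ℝ} (hX : StrictMono X) (hXq : q (t + 2) = ∏ k, (Polynomial.X - C (X k))) (hy : StrictMono y) (hyq : q' (t + 2) = ∏ k, (Polynomial.X - C (y k))) :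
    y 0 < X 0 ∧ X (Fin.last (t + 1)) < y (Fin.last (t + 1)) ∧ ∀ (k : Fin (t + 2)) (hk : (k : ℕ) + 1 ≤ t + 1), y k ≤ X ⟨k + 1, by omega⟩ ∧ X k ≤ y ⟨k + 1, by omega⟩ := by
  have hb'pos : ∀ j, 0 < b' j := fun j => by
    by_cases h : j = t + 1
    · rw [h, hbt]; exact mul_pos two_pos (hb _)
    · rw [hb' j h]; exact hb j
  have hle : ∀ j, 1 ≤ j → j ≤ t + 1 → b j ≤ b' j := fun j _ hj => by
    by_cases h : j = t + 1
    · rw [h, hbt]; linarith [hb (t + 1)]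
    · rw [hb' j h]
  have hlt : b (t + 1) < b' (t + 1) := by rw [hbt]; linarith [hb (t + 1)]
  refine ⟨bottom_zero_strictAnti_offdiag hq0 hq1 hrec hq0' hq1' hrec' hb hb'pos (t := t + 1) hle (j₀ := t + 1) (by omega) le_rfl hlt hX hXq hy hyq,
    top_zero_strictMono_offdiag hq0 hq1 hrec hq0' hq1' hrec' hb hb'pos (t := t + 1) hle (j₀ := t + 1) (by omega) le_rfl hlt hX hXq hy hyq, fun k hk => ?_⟩
  exact zeros_single_coupling_interlace hq0 hq1 hrec hq0' hq1' hrec' hb hb'pos (j₀ := t + 1) hb' hX hXq hy hyq k hk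

end Summit.Ventures.HSemireg.Wedge.HankelOuter
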